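import Summits.QuantumFields.YangMills.Theorems.BalabanUVNodesN15CovariantAveragingHolonomyLineFit
import Summits.QuantumFields.YangMills.Theorems.BalabanUVNodesN15PerCubeGreenFineSummand
import Summits.QuantumFields.YangMills.Theorems.BalabanUVNodesN15CovariantTwoGridPairingLetters
import HarnessLib

/-!
# N15 = NE2, road (c) — PROGRAMME (PC) «[B9] Sect. C FOR THE LANDAU LETTER WITH PER-CUBE GAUGES (3.35) AS PRINTED», (PC-E) (C6-d3) STEP 1: THE STAIRCASE HOLONOMY WITHIN A KING CELL —
# two staircases `U(Γ_{y,c})`, `U(Γ_{y,c′})` from the block's base point to block points `c ≥ c′` with `c − c′ ≤ K` coordinatewise differ by at most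
# `(d+1)·(d·n·K·b + ((1+ρ)^K − 1))`: leg by leg, a leg either loses a tail of `≤ K` bonds (`(1+ρ)^K − 1`) or is translated transversally by `≤ K` steps (`n·K·b` by the
# all-direction step letter `b`), unitary factors costing nothing (dag-n15-c g32, n15-c∕349)

Cell `pub-ymgap`, seat `pub-ymgap-dag-n15-c` (generation g32; R134 (a) seat, strategy s1 «first missing estimate»; HUMAN RULING D-0062; chair R424 venue).
`bears_on: R4∕N15 · K3⁸ SpineGivenEndpointR13SepCoPHV (stmt-QuantumFields-27366)`; filed `--kind proof --supports stmt-QuantumFields-27366 --as helper` — COUNT-NEUTRAL.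
THEOREMS only ([folklore] products of unitary matrices along lattice staircases), 0 `def`, 0 `sorry`.  Imports BY NAME n15-c∕185a∕183∕184 `holStair`∕`holLeg`∕`mprod` (`…CovariantAveragingHolonomy*`:
`norm_unitary_mul_eq`, `norm_mul_unitary_eq`, `norm_mprod_sub_one_le`, `conjTranspose_mprod_mul_self`, `mprod_add`), n15-c∕341 `norm_chain_sub_le`,
`stair`∕`bondAt`∕`bpt`∕`tstep` bookkeeping (`stair_of_lt`, `bpt_add_tstep_of_lt`, `tstep_succ`, `kingBlockOf_bpt`).  Nothing in the tree is modified, no landed name re-declared.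

WHY ((C6-d3) = n15-c∕340's displayed `hDNV`, the two-grid defect of the cut Gram perturbation `M_ψ(aQ₁ᵀQ₁ − Q_TᵀQ_T)M_χ`).  Under King's covariant pairing the coarse staircase transport to
`x = πx′` IS the fine staircase transport to the cell corner `σπx′` (sequel), so the defect is driven by `U′(Γ′_{y,x′}) − U′(Γ′_{y,σπx′})`: two fine staircases in one block whose targets
differ by `< L^r` in every coordinate.  ★★ `norm_holStair_sub_holStair_le`: for a unitary bond field with `‖U − 1‖ ≤ ρ` and the all-direction step letter `‖U_μ(z+e_κ) − U_μ(z)‖ ≤ b`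
on the block, `‖U(Γ_{y,c}) − U(Γ_{y,c′})‖ ≤ (d+1)(d·nKb + (1+ρ)^K − 1)` whenever `c′ ≤ c ≤ c′ + K`; at `n = L^rL^k`, `K = L^r`, `b = η′²q`, `ρ = η′p` this is `O(ηq + ηp)` = `O(η)`.
Route: hybrid staircases `h_j = (c′_0,…,c′_{j−1},c_j,…,c_d)` (★ `norm_holStair_sub_holStair_update_le`: one coordinate changes — legs before it agree, the leg itself loses a tail,
the legs after it are translated by `≤ K` steps in that one direction; ★ `norm_mprod_sub_mprod_le_of_unitary`: `‖ΠF − ΠG‖ ≤ Σ‖F_i − G_i‖` for unitary factors).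

HONEST FRAMING ∕ LIMITS.  Elementary; abstract unitary bond field on one block of the fine torus; nothing of [B7]∕[B9] asserted ((3.57)–(3.58) pp.401–402, (3.73) p.405 = SHAPES of the
two-spacing transport comparison).  NE2⁺ NOT PRINTED, NOT proved; N15 of record untouched (DISCHARGED AS CONSUMED, p687738); K3⁸ OPEN; counts of record UNMOVED (typed 28∕28 ·
discharged 8∕27); one finite 𝕋⁴ at fixed ε per index — NOT infinite volume, NOT OS on ℝ⁴, NOT a mass gap, NOT Clay.  Restate-immune (no Theses import).
-/

set_option autoImplicit false

noncomputable section

open scoped BigOperators Matrix Matrix.Norms.L2Operator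
open Finset

namespace Summit.QuantumFields.YangMills.BalabanUVNodes.N15.CovAvg

open Literature.MathematicalPhysics.QuantumFieldTheory.Balaban1983to89
open Literature.MathematicalPhysics.QuantumFieldTheory.Balaban1983to89.B5Prop11Plancherel (Tor fine unitVec)
open Literature.MathematicalPhysics.QuantumFieldTheory.Balaban1983to89.B5Block118 (bpt tstep tstep_succ tstep_zero)
open Literature.MathematicalPhysics.QuantumFieldTheory.Balaban1983to89.Beta.FluctuationProjection (bpt_add_tstep_of_lt)
open Literature.MathematicalPhysics.QuantumFieldTheory.King1986.Torus (blockOf)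
open Summit.QuantumFields.YangMills.BalabanUVNodes.N15.VectorPiece (bondAt stair stair_of_lt stair_self stair_of_gt)
open Summit.QuantumFields.YangMills.BalabanUVNodes.N15.DefectKernel (kingBlockOf_bpt)

variable {d : ℕ} {mm : Type} [Fintype mm] [DecidableEq mm]

/-! ## §1 Products of unitary factors -/

/-- ★ `‖Π_{i<N}F_i − Π_{i<N}G_i‖ ≤ Σ_{i<N}‖F_i − G_i‖` for unitary factors (operator norm). [folklore] -/
theorem norm_mprod_sub_mprod_le_of_unitary {F G : ℕ → Matrix mm mm ℂ} {N : ℕ} (hF : ∀ i < N, (F i)ᴴ * F i = 1) (hG : ∀ i < N, (G i)ᴴ * G i = 1) :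
    ‖mprod F N - mprod G N‖ ≤ ∑ i ∈ range N, ‖F i - G i‖ := by
  induction N with
  | zero => simp
  | succ N ih =>
      have hF' : ∀ i < N, (F i)ᴴ * F i = 1 := fun i hi => hF i (Nat.lt_succ_of_lt hi)
      have hG' : ∀ i < N, (G i)ᴴ * G i = 1 := fun i hi => hG i (Nat.lt_succ_of_lt hi)
      rw [mprod_succ, mprod_succ, Finset.sum_range_succ]
      have e : mprod F N * F N - mprod G N * G N = (mprod F N - mprod G N) * F N + mprod G N * (F N - G N) := by
        rw [sub_mul, Matrix.mul_sub]; abel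
      rw [e]
      calc ‖(mprod F N - mprod G N) * F N + mprod G N * (F N - G N)‖ ≤ ‖(mprod F N - mprod G N) * F N‖ + ‖mprod G N * (F N - G N)‖ := norm_add_le _ _
        _ = ‖mprod F N - mprod G N‖ + ‖F N - G N‖ := by
            rw [norm_mul_unitary_eq (hF N (Nat.lt_succ_self N)), norm_unitary_mul_eq (conjTranspose_mprod_mul_self hG')]
        _ ≤ (∑ i ∈ range N, ‖F i - G i‖) + ‖F N - G N‖ := by linarith [ih hF' hG']

/-! ## §2 Two staircases in one block -/

section Stair

variable (M : Fin (d + 1) → ℕ) [∀ μ, NeZero (M μ)] (n : ℕ) [NeZero n]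

omit [Fintype mm] [DecidableEq mm] in
/-- the staircase offsets of two coordinate vectors that agree below the running leg coincide. [folklore] -/
theorem stair_congr_of_lt {u u' : Fin (d + 1) → Fin n} {i : Fin (d + 1)} (h : ∀ ν, ν < i → u ν = u' ν) (s : Fin n) : stair u i s = stair u' i s := by
  funext ν
  simp only [stair]
  split_ifs with h1
  · exact h ν h1
  · rfl
  · rfl

/-- a transversal translation by `o` steps in direction `κ` inside the block costs `o·b`. [folklore] -/
theorem norm_sub_tstep_le (V : Fin (d + 1) → Tor (fine n M) → Matrix mm mm ℂ) (y : Tor M) {b : ℝ}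
    (hby : ∀ κ μ z, blockOf n M z = y → ‖V μ (z + unitVec (fine n M) κ) - V μ z‖ ≤ b) (μ κ : Fin (d + 1)) (z : Tor (fine n M)) :
    ∀ o : ℕ, (∀ t, t < o → blockOf n M (z + tstep (fine n M) κ t) = y) → ‖V μ (z + tstep (fine n M) κ o) - V μ z‖ ≤ o * b := by
  intro o
  induction o with
  | zero => intro _; rw [tstep_zero, add_zero, sub_self, norm_zero, Nat.cast_zero, zero_mul]
  | succ o ih =>
      intro ho
      have h1 := ih (fun t ht => ho t (Nat.lt_succ_of_lt ht))
      have h2 : ‖V μ (z + tstep (fine n M) κ (o + 1)) - V μ (z + tstep (fine n M) κ o)‖ ≤ b := by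
        rw [tstep_succ, ← add_assoc]
        exact hby κ μ _ (ho o (Nat.lt_succ_self o))
      calc ‖V μ (z + tstep (fine n M) κ (o + 1)) - V μ z‖
          ≤ ‖V μ (z + tstep (fine n M) κ (o + 1)) - V μ (z + tstep (fine n M) κ o)‖ + ‖V μ (z + tstep (fine n M) κ o) - V μ z‖ := norm_sub_le_norm_sub_add_norm_sub _ _ _
        _ ≤ b + o * b := add_le_add h2 h1
        _ = ((o + 1 : ℕ) : ℝ) * b := by push_cast; ring

/-- ★ **ONE COORDINATE CHANGES**: if `u′` agrees with `u` except at coordinate `j`, where `u′_j ≤ u_j ≤ u′_j + K`, the two staircase holonomies differ by `≤ d·nKb + ((1+ρ)^K − 1)`: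
the legs `i < j` agree, leg `j` loses a tail of `≤ K` unitary bonds each within `ρ` of `1`, the legs `i > j` (same lengths `≤ n`) are translated by `u_j − u′_j ≤ K` steps in direction `j`.
[cite: Balaban1985BackgroundPropagators, (3.57)–(3.58) pp.401–402 (shape)] -/
theorem norm_holStair_sub_holStair_update_le (V : Fin (d + 1) → Tor (fine n M) → Matrix mm mm ℂ) (hV : ∀ μ z, (V μ z)ᴴ * V μ z = 1) (y : Tor M) {ρ b : ℝ} (hρ : 0 ≤ ρ) (hb : 0 ≤ b)
    (hρy : ∀ μ z, blockOf n M z = y → ‖V μ z - 1‖ ≤ ρ) (hby : ∀ κ μ z, blockOf n M z = y → ‖V μ (z + unitVec (fine n M) κ) - V μ z‖ ≤ b)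
    (u u' : Fin (d + 1) → Fin n) (j : Fin (d + 1)) (hdiff : ∀ i, i ≠ j → u' i = u i) (hle : (u' j : ℕ) ≤ u j) {K : ℕ} (hK : (u j : ℕ) - u' j ≤ K) (ν : Fin (d + 1)) :
    ‖holStair M n (fun μ q => V μ q.1) y u ν - holStair M n (fun μ q => V μ q.1) y u' ν‖ ≤ d * ((n : ℝ) * (K * b)) + ((1 + ρ) ^ K - 1) := by
  have hn : 0 < n := Nat.pos_of_ne_zero (NeZero.ne n)
  have hKb : 0 ≤ (n : ℝ) * (K * b) := by positivity
  have hE : 0 ≤ (1 + ρ) ^ K - 1 := by have := one_le_pow₀ (M₀ := ℝ) (a := 1 + ρ) (by linarith) (n := K); linarith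
  set o : ℕ := (u j : ℕ) - u' j with ho
  have hoj : (u' j : ℕ) + o = u j := by omega
  -- the legs
  have hlegU : ∀ (w : Fin (d + 1) → Fin n) (i : ℕ) (hi : i < d + 1),
      (fun i => if h : i < d + 1 then holLeg M n (fun μ q => V μ q.1) y w ⟨i, h⟩ ν else 1) i = mprod (fun t => V ⟨i, hi⟩ (bpt n M y (stair w ⟨i, hi⟩ ⟨t % n, Nat.mod_lt _ hn⟩))) (w ⟨i, hi⟩) := by
    intro w i hi; simp only [dif_pos hi]; rfl
  have hunit : ∀ (w : Fin (d + 1) → Fin n) (i : ℕ), i < d + 1 → ((fun i => if h : i < d + 1 then holLeg M n (fun μ q => V μ q.1) y w ⟨i, h⟩ ν else 1) i)ᴴ *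
      (fun i => if h : i < d + 1 then holLeg M n (fun μ q => V μ q.1) y w ⟨i, h⟩ ν else 1) i = 1 := by
    intro w i hi; rw [hlegU w i hi]; exact conjTranspose_mprod_mul_self fun t _ => hV _ _
  -- leg by leg
  have hleg : ∀ i ∈ range (d + 1), ‖(fun i => if h : i < d + 1 then holLeg M n (fun μ q => V μ q.1) y u ⟨i, h⟩ ν else 1) i -
      (fun i => if h : i < d + 1 then holLeg M n (fun μ q => V μ q.1) y u' ⟨i, h⟩ ν else 1) i‖ ≤ if i = (j : ℕ) then (1 + ρ) ^ K - 1 else (n : ℝ) * (K * b) := by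
    intro i hi
    have hi' : i < d + 1 := Finset.mem_range.mp hi
    rw [hlegU u i hi', hlegU u' i hi']
    by_cases hij : i = (j : ℕ)
    · -- the changed leg: a common prefix of length `u′_j`, then a tail of `o ≤ K` bonds
      rw [if_pos hij]
      have hjF : (⟨i, hi'⟩ : Fin (d + 1)) = j := Fin.ext hij
      rw [hjF]
      have hst : ∀ s : Fin n, stair u j s = stair u' j s := fun s => stair_congr_of_lt n (fun ν' hν' => (hdiff ν' (ne_of_lt hν')).symm) s
      set F : ℕ → Matrix mm mm ℂ := fun t => V j (bpt n M y (stair u' j ⟨t % n, Nat.mod_lt _ hn⟩)) with hF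
      have eF : (fun t => V j (bpt n M y (stair u j ⟨t % n, Nat.mod_lt _ hn⟩))) = F := by funext t; rw [hF, hst]
      rw [eF, ← hoj, mprod_add]
      have hpre : (mprod F (u' j : ℕ))ᴴ * mprod F (u' j : ℕ) = 1 := conjTranspose_mprod_mul_self fun t _ => hV _ _
      have htail : ‖mprod (fun t => F ((u' j : ℕ) + t)) o - 1‖ ≤ (1 + ρ) ^ K - 1 :=
        (norm_mprod_sub_one_le hρ (fun t _ => hρy _ _ (kingBlockOf_bpt _ _ _ _))).trans (by
          have h1 : (1 : ℝ) ≤ 1 + ρ := by linarith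
          linarith [pow_le_pow_right₀ h1 hK])
      calc ‖mprod F (u' j : ℕ) * mprod (fun t => F ((u' j : ℕ) + t)) o - mprod F (u' j : ℕ)‖
          = ‖mprod F (u' j : ℕ) * (mprod (fun t => F ((u' j : ℕ) + t)) o - 1)‖ := by rw [Matrix.mul_sub, Matrix.mul_one]
        _ = ‖mprod (fun t => F ((u' j : ℕ) + t)) o - 1‖ := norm_unitary_mul_eq hpre _
        _ ≤ (1 + ρ) ^ K - 1 := htail
    · rw [if_neg hij]
      have hiF : (⟨i, hi'⟩ : Fin (d + 1)) ≠ j := fun h => hij (by rw [← h])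
      have hlen : u' ⟨i, hi'⟩ = u ⟨i, hi'⟩ := hdiff _ hiF
      rw [hlen]
      refine (norm_mprod_sub_mprod_le_of_unitary (N := (u ⟨i, hi'⟩ : ℕ)) (fun t _ => hV _ _) (fun t _ => hV _ _)).trans ?_
      rcases lt_or_gt_of_ne hiF with hlt | hgt
      · -- a leg before the changed coordinate: identical
        have hst : ∀ s : Fin n, stair u ⟨i, hi'⟩ s = stair u' ⟨i, hi'⟩ s := fun s =>
          stair_congr_of_lt n (fun ν' hν' => (hdiff ν' (ne_of_lt (lt_trans hν' hlt))).symm) s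
        calc ∑ t ∈ range (u ⟨i, hi'⟩ : ℕ), ‖V ⟨i, hi'⟩ (bpt n M y (stair u ⟨i, hi'⟩ ⟨t % n, Nat.mod_lt _ hn⟩)) - V ⟨i, hi'⟩ (bpt n M y (stair u' ⟨i, hi'⟩ ⟨t % n, Nat.mod_lt _ hn⟩))‖
            = 0 := Finset.sum_eq_zero fun t _ => by rw [hst, sub_self, norm_zero]
          _ ≤ (n : ℝ) * (K * b) := hKb
      · -- a leg after the changed coordinate: translated by `o` steps in direction `j`
        have hpt : ∀ s : Fin n, bpt n M y (stair u ⟨i, hi'⟩ s) = bpt n M y (stair u' ⟨i, hi'⟩ s) + tstep (fine n M) j o := by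
          intro s
          have hsj : (stair u' ⟨i, hi'⟩ s j : ℕ) + o < n := by rw [stair_of_lt u' s hgt]; omega
          rw [bpt_add_tstep_of_lt (h := hsj)]
          congr 1
          funext ν'
          by_cases hν : ν' = j
          · subst hν
            rw [Function.update_self, stair_of_lt u s hgt]
            exact Fin.ext (by simp only [stair_of_lt u' s hgt]; omega)
          · rw [Function.update_of_ne hν]
            simp only [stair]
            split_ifs with h1
            · exact (hdiff ν' hν).symm
            · rfl
            · rfl
        have hblk : ∀ (s : Fin n) (t : ℕ), t < o → blockOf n M (bpt n M y (stair u' ⟨i, hi'⟩ s) + tstep (fine n M) j t) = y := by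
          intro s t ht
          have hsj : (stair u' ⟨i, hi'⟩ s j : ℕ) + t < n := by rw [stair_of_lt u' s hgt]; omega
          rw [bpt_add_tstep_of_lt (h := hsj)]; exact kingBlockOf_bpt _ _ _ _
        calc ∑ t ∈ range (u ⟨i, hi'⟩ : ℕ), ‖V ⟨i, hi'⟩ (bpt n M y (stair u ⟨i, hi'⟩ ⟨t % n, Nat.mod_lt _ hn⟩)) - V ⟨i, hi'⟩ (bpt n M y (stair u' ⟨i, hi'⟩ ⟨t % n, Nat.mod_lt _ hn⟩))‖
            ≤ ∑ _t ∈ range (u ⟨i, hi'⟩ : ℕ), (o : ℝ) * b := Finset.sum_le_sum fun t _ => by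
                rw [hpt]; exact norm_sub_tstep_le M n V y hby _ j _ o (hblk _)
          _ = (u ⟨i, hi'⟩ : ℕ) * ((o : ℝ) * b) := by rw [Finset.sum_const, Finset.card_range, nsmul_eq_mul]
          _ ≤ (n : ℝ) * (K * b) := mul_le_mul (by exact_mod_cast (u ⟨i, hi'⟩).isLt.le) (mul_le_mul_of_nonneg_right (by exact_mod_cast hK) hb) (by positivity) (by positivity)
  -- sum over the legs
  unfold holStair
  refine (norm_mprod_sub_mprod_le_of_unitary (hunit u) (hunit u')).trans ((Finset.sum_le_sum hleg).trans (le_of_eq ?_))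
  rw [Finset.sum_ite, Finset.sum_const, Finset.sum_const, nsmul_eq_mul, nsmul_eq_mul]
  have h1 : ((range (d + 1)).filter (fun i => i = (j : ℕ))).card = 1 := by
    rw [Finset.card_eq_one]; exact ⟨(j : ℕ), by ext i; simp only [Finset.mem_filter, Finset.mem_range, Finset.mem_singleton]; constructor <;> intro h <;> [exact h.2; exact ⟨h ▸ j.isLt, h⟩]⟩
  have h2 : ((range (d + 1)).filter (fun i => ¬ i = (j : ℕ))).card = d := by
    have h := Finset.card_filter_add_card_filter_not (s := range (d + 1)) (fun i => i = (j : ℕ))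
    rw [h1, Finset.card_range] at h; omega
  rw [h1, h2]; push_cast; ring

/-- ★★ **TWO STAIRCASES IN ONE BLOCK**: for a unitary bond field with `‖U − 1‖ ≤ ρ` and the all-direction step letter `b` on the block of `y`, and block points `c′ ≤ c ≤ c′ + K`
(coordinatewise), `‖U(Γ_{y,c}) − U(Γ_{y,c′})‖ ≤ (d+1)·(d·nKb + ((1+ρ)^K − 1))` (hybrid staircases, one coordinate at a time).  At `n = L^rL^k`, `K = L^r` (the King cell), `b = η′²q`,
`ρ = η′p`: `O(ηq + ηp)`. [cite: Balaban1985BackgroundPropagators, (3.57)–(3.58) pp.401–402, (3.73) p.405 (shapes); King1986, p.664 (pairing convention)] -/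
theorem norm_holStair_sub_holStair_le (V : Fin (d + 1) → Tor (fine n M) → Matrix mm mm ℂ) (hV : ∀ μ z, (V μ z)ᴴ * V μ z = 1) (y : Tor M) {ρ b : ℝ} (hρ : 0 ≤ ρ) (hb : 0 ≤ b)
    (hρy : ∀ μ z, blockOf n M z = y → ‖V μ z - 1‖ ≤ ρ) (hby : ∀ κ μ z, blockOf n M z = y → ‖V μ (z + unitVec (fine n M) κ) - V μ z‖ ≤ b)
    (c c' : Fin (d + 1) → Fin n) (hle : ∀ i, (c' i : ℕ) ≤ c i) {K : ℕ} (hK : ∀ i, (c i : ℕ) - c' i ≤ K) (ν : Fin (d + 1)) :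
    ‖holStair M n (fun μ q => V μ q.1) y c ν - holStair M n (fun μ q => V μ q.1) y c' ν‖ ≤ (d + 1) * (d * ((n : ℝ) * (K * b)) + ((1 + ρ) ^ K - 1)) := by
  -- the hybrid staircases `h_j = (c′_0, …, c′_{j−1}, c_j, …, c_d)`
  set h : ℕ → (Fin (d + 1) → Fin n) := fun j i => if (i : ℕ) < j then c' i else c i with hh
  have h0 : h 0 = c := funext fun i => by simp [hh]
  have hd : h (d + 1) = c' := funext fun i => by simp [hh, i.isLt]
  have hstep : ∀ j < d + 1, ‖holStair M n (fun μ q => V μ q.1) y (h j) ν - holStair M n (fun μ q => V μ q.1) y (h (j + 1)) ν‖ ≤ d * ((n : ℝ) * (K * b)) + ((1 + ρ) ^ K - 1) := by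
    intro j hj
    refine norm_holStair_sub_holStair_update_le M n V hV y hρ hb hρy hby (h j) (h (j + 1)) ⟨j, hj⟩ (fun i hi => ?_) ?_ ?_ ν
    · have hij : (i : ℕ) ≠ j := fun e => hi (Fin.ext e)
      simp only [hh]
      by_cases h1 : (i : ℕ) < j
      · rw [if_pos h1, if_pos (Nat.lt_succ_of_lt h1)]
      · rw [if_neg h1, if_neg (by omega)]
    · simp only [hh, lt_irrefl, if_false, Nat.lt_succ_self, if_true]; exact hle _
    · simp only [hh, lt_irrefl, if_false, Nat.lt_succ_self, if_true]; exact hK _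
  have hmain := norm_chain_sub_le (fun j => holStair M n (fun μ q => V μ q.1) y (h j) ν) (N := d + 1) hstep
  rw [h0, hd] at hmain
  exact_mod_cast hmain

end Stair

end Summit.QuantumFields.YangMills.BalabanUVNodes.N15.CovAvg

end
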